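import Literature.Probability.RandomPlanarGeometry.InvertedExterior
import Literature.Probability.RandomPlanarGeometry.ConformalMapCaratheodoryProofs
import Literature.Probability.RandomPlanarGeometry.ConformalMapRiemannProofs
import Literature.Probability.RandomPlanarGeometry.JordanDomainProofs
import Literature.Probability.RandomPlanarGeometry.JordanBoundaryLemmas
import HarnessLib

/-!
# Two-sided tubular coordinates about a Jordan curve

Topic `Literature/Probability/RandomPlanarGeometry`; family `conformal-planar`. For a Jordan
domain `D` we build *two-sided collar coordinates* about `∂D` from the Carathéodory
homeomorphisms of the closed disc onto `closure D` (interior chart) and onto the closure of the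
inverted exterior `D*` (`InvertedExterior.lean`; exterior chart, centred so that the disc centre
corresponds to `∞`): `tube s t` is, for `0 ≤ s ≤ 1`, the image of the point at radius `s` on the
ray of the interior chart ending at the boundary point `∂D(t)`, and, for `1 ≤ s < 2`, the image
of the point at radius `2 - s` on the corresponding ray of the exterior chart. Thus
`tube 1 t = ∂D(t)`, `tube s t ∈ D` for `s < 1`, `tube s t ∉ closure D` for `s > 1`; `tube` is
continuous and injective on `(0, 2) × [0, 1)`, `tube s t → ∂D(t)` uniformly as `s → 1`, and the
levels `s ≤ 1 - h`, resp. `1 + h ≤ s ≤ 3/2`, keep a positive distance from `∂D`, resp. from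
`closure D`. These are the coordinates in which neighbourhoods of a Jordan domain "on both sides
of each boundary arc" are cut out (Bollobás–Riordan, *Percolation* (2006), Ch. 7 p. 186: the
domains `D'`, `D''` of Figure 14, which the source builds from sausage neighbourhoods instead).

* `JordanDomain.DiscChart D`: a Carathéodory homeomorphism of the closed disc onto `closure D`
  (`exists_discChart_apply_eq`: based at any `z ∈ D`); `DiscChart.β`: the boundary correspondence
  `ℝ → ∂𝔻`, `Φ (β t) = ∂D(t)`.
* `JordanDomain.TubeData D` and `TubeData.tube`; `tube_one`, `tube_mem_carrier`,
  `tube_not_mem_closure`, `continuousOn_tube`, `injOn_tube`, `exists_dist_tube_lt`,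
  `exists_le_infDist_tube_inner/outer`, `exists_inner_escape`, `exists_outer_escape`.

## References

* B. Bollobás, O. Riordan, *Percolation*, Cambridge University Press (2006), Ch. 7 p. 186.
* Ch. Pommerenke, *Boundary Behaviour of Conformal Maps*, Springer (1992), Thm. 2.6, §2.1.

## Mathlib / tree

Mathlib: `Continuous.homeoOfEquivCompactToT2`, `Set.BijOn.equiv`, `ContinuousOn.if`,
`IsCompact.uniformContinuousOn_of_continuous`, `IsCompact.exists_isMinOn`. Tree:
`ConformalMapRiemannProofs` (`exists_conformalEquiv_ball_apply_eq_zero`),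
`ConformalMapCaratheodoryProofs` (`JordanDomain.exists_continuousOn_extension_holds`),
`JordanDomainProofs` (`isSimplyConnected_holds`), `InvertedExterior` (`JordanDomain.inverted`).
-/

noncomputable section

open Set Metric Topology Filter Bornology

namespace Literature.Probability.RandomPlanarGeometry

namespace JordanDomain

variable {D : JordanDomain}

/-! ### Carathéodory charts -/

/-- A **Carathéodory chart** of a Jordan domain: a continuous bijection of the closed unit disc onto
`closure D` taking the open disc onto `D` and the circle onto `∂D` (Riemann map + Carathéodory's
theorem). [cite: Pommerenke1992, Thm. 2.6] -/
structure DiscChart (D : JordanDomain) where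
  /-- The Riemann map of the disc onto `D`. -/
  φ : ConformalEquiv (ball (0 : ℂ) 1) D.carrier
  /-- The chart (Carathéodory extension of `φ`, junk off the closed disc). -/
  Φ : ℂ → ℂ
  /-- Continuity on the closed disc. -/
  continuousOn : ContinuousOn Φ (closedBall 0 1)
  /-- On the open disc the chart is the Riemann map. -/
  eqOn : EqOn Φ φ (ball 0 1)
  /-- The closed disc goes onto `closure D`. -/
  bijOn : BijOn Φ (closedBall 0 1) (closure D.carrier)
  /-- The circle goes onto `∂D`. -/
  bijOn_sphere : BijOn Φ (sphere 0 1) (frontier D.carrier)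

/-- **Existence of Carathéodory charts based at a given point**: for `z ∈ D` there is a chart with
`Φ 0 = z`. [cite: Pommerenke1992, Thm. 2.6] -/
theorem exists_discChart_apply_eq (D : JordanDomain) {z : ℂ} (hz : z ∈ D.carrier) : ∃ C : D.DiscChart, C.Φ 0 = z := by
  obtain ⟨φ, hφ⟩ := exists_conformalEquiv_ball_apply_eq_zero D.isOpen D.isSimplyConnected_holds D.carrier_ne_univ hz
  obtain ⟨Φ, hcont, heq, hbij, hsph⟩ := JordanDomain.exists_continuousOn_extension_holds D φ.symm
  refine ⟨⟨φ.symm, Φ, hcont, heq, hbij, hsph⟩, ?_⟩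
  show Φ 0 = z
  rw [heq (mem_ball_self one_pos)]
  have := φ.symm_apply_apply hz
  rwa [hφ] at this

namespace DiscChart

variable (C : D.DiscChart)

/-- The open disc goes onto `D`. [folklore] -/
theorem bijOn_ball : BijOn C.Φ (ball 0 1) D.carrier := by
  have hb : BijOn C.φ (ball 0 1) D.carrier := by
    have := C.φ.toPartialEquiv.bijOn
    rwa [C.φ.source_eq, C.φ.target_eq] at this
  exact (C.eqOn.bijOn_iff).2 hb

/-- **Continuity of the inverse chart on `D`**: `φ.symm` is continuous on `D` and inverts `Φ` on the
open disc. [folklore] -/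
theorem symm_apply_Φ {u : ℂ} (hu : u ∈ ball (0 : ℂ) 1) : C.φ.symm (C.Φ u) = u := by
  rw [C.eqOn hu]; exact C.φ.symm_apply_apply hu

/-- The chart is injective on the closed disc. [folklore] -/
theorem injOn : InjOn C.Φ (closedBall 0 1) := C.bijOn.injOn

/-- Points of the open disc go into `D`. [folklore] -/
theorem apply_mem_carrier {u : ℂ} (hu : ‖u‖ < 1) : C.Φ u ∈ D.carrier :=
  C.bijOn_ball.mapsTo (mem_ball_zero_iff.2 hu)

/-- Points of the closed disc go into `closure D`. [folklore] -/
theorem apply_mem_closure {u : ℂ} (hu : ‖u‖ ≤ 1) : C.Φ u ∈ closure D.carrier :=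
  C.bijOn.mapsTo (mem_closedBall_zero_iff.2 hu)

/-- Points of the circle go onto `∂D`. [folklore] -/
theorem apply_mem_frontier {u : ℂ} (hu : ‖u‖ = 1) : C.Φ u ∈ frontier D.carrier :=
  C.bijOn_sphere.mapsTo (mem_sphere_zero_iff_norm.2 hu)

/-- The chart restricted to the circle, as a homeomorphism onto `∂D` (a continuous bijection of a
compact space onto a Hausdorff space). [folklore] -/
def sphereHomeo : sphere (0 : ℂ) 1 ≃ₜ frontier D.carrier :=
  Continuous.homeoOfEquivCompactToT2 (f := C.bijOn_sphere.equiv C.Φ)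
    ((C.continuousOn.mono sphere_subset_closedBall).mapsToRestrict C.bijOn_sphere.mapsTo)

/-- The homeomorphism is the chart. [folklore] -/
@[simp] theorem sphereHomeo_apply_coe (u : sphere (0 : ℂ) 1) : (C.sphereHomeo u : ℂ) = C.Φ u := rfl

/-- **The boundary correspondence**: the point of the circle sent to `∂D(t)`. [folklore] -/
def β (t : ℝ) : ℂ := (C.sphereHomeo.symm ⟨D.boundary t, D.boundary_mem_frontier t⟩ : sphere (0 : ℂ) 1)

/-- `‖β t‖ = 1`. [folklore] -/
theorem norm_β (t : ℝ) : ‖C.β t‖ = 1 :=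
  mem_sphere_zero_iff_norm.1 (C.sphereHomeo.symm ⟨D.boundary t, D.boundary_mem_frontier t⟩).2

/-- `Φ (β t) = ∂D(t)`. [folklore] -/
@[simp] theorem apply_β (t : ℝ) : C.Φ (C.β t) = D.boundary t := by
  have := C.sphereHomeo.apply_symm_apply ⟨D.boundary t, D.boundary_mem_frontier t⟩
  exact congrArg Subtype.val this

/-- `β` is continuous. [folklore] -/
theorem continuous_β : Continuous C.β :=
  continuous_subtype_val.comp (C.sphereHomeo.symm.continuous.comp
    (D.continuous_boundary.subtype_mk fun t => D.boundary_mem_frontier t))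

/-- `β` is `1`-periodic. [folklore] -/
theorem periodic_β : Function.Periodic C.β 1 := fun t => by
  simp only [β, D.periodic_boundary t]

/-- `β` is injective on a period. [folklore] -/
theorem injOn_β : InjOn C.β (Ico 0 1) := fun s hs t ht h => by
  have h' := congrArg C.Φ h
  rw [apply_β, apply_β] at h'
  exact D.injOn_boundary hs ht h'

/-- `Φ u = Φ 0` forces `u = 0` on the closed disc. [folklore] -/
theorem eq_zero_of_apply_eq {u : ℂ} (hu : ‖u‖ ≤ 1) (h : C.Φ u = C.Φ 0) : u = 0 :=
  C.injOn (mem_closedBall_zero_iff.2 hu) (mem_closedBall_self zero_le_one) h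

end DiscChart

/-! ### Tube data and the two-sided tube -/

/-- **Tube data** of a Jordan domain: a centre `z₀ ∈ D`, an interior chart based at `z₀` and an
exterior chart (a chart of the inverted exterior `D*` with respect to `z₀`) based at `0 = ι(∞)`.
[cite: BollobasRiordan2006, Ch. 7 p. 186] -/
structure TubeData (D : JordanDomain) where
  /-- The centre. -/
  z₀ : ℂ
  /-- The centre lies in `D`. -/
  hz₀ : z₀ ∈ D.carrier
  /-- The interior chart. -/
  Ci : D.DiscChart
  /-- The exterior chart. -/
  Ce : (D.inverted hz₀).DiscChart
  /-- The interior chart is based at `z₀`. -/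
  Ci_zero : Ci.Φ 0 = z₀
  /-- The exterior chart is based at `0 = ι(∞)`. -/
  Ce_zero : Ce.Φ 0 = 0

/-- Tube data exist. [cite: Pommerenke1992, Thm. 2.6] -/
theorem nonempty_tubeData (D : JordanDomain) : Nonempty D.TubeData := by
  obtain ⟨z₀, hz₀⟩ := D.nonempty
  obtain ⟨Ci, hCi⟩ := D.exists_discChart_apply_eq hz₀
  obtain ⟨Ce, hCe⟩ := (D.inverted hz₀).exists_discChart_apply_eq ((D.zero_mem_inverted hz₀))
  exact ⟨⟨z₀, hz₀, Ci, Ce, hCi, hCe⟩⟩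

namespace TubeData

variable (T : D.TubeData)

/-- **The two-sided tube** about `∂D`: radius-`s` point on the interior ray to `∂D(t)` for
`s ≤ 1`, radius-`(2 - s)` point on the exterior ray for `s > 1` (see the module docstring).
[cite: BollobasRiordan2006, Ch. 7 p. 186] -/
def tube (s t : ℝ) : ℂ :=
  if s ≤ 1 then T.Ci.Φ ((s : ℂ) * T.Ci.β t) else invMapInv T.z₀ (T.Ce.Φ (((2 - s : ℝ) : ℂ) * T.Ce.β t))

/-- The interior branch. [folklore] -/
theorem tube_of_le_one {s : ℝ} (hs : s ≤ 1) (t : ℝ) : T.tube s t = T.Ci.Φ ((s : ℂ) * T.Ci.β t) := if_pos hs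

/-- The exterior branch. [folklore] -/
theorem tube_of_one_lt {s : ℝ} (hs : 1 < s) (t : ℝ) :
    T.tube s t = invMapInv T.z₀ (T.Ce.Φ (((2 - s : ℝ) : ℂ) * T.Ce.β t)) := if_neg (not_le.2 hs)

/-- Norm of a real multiple of a unit vector. [folklore] -/
theorem norm_real_mul_of_norm_eq_one {s : ℝ} {u : ℂ} (hu : ‖u‖ = 1) : ‖(s : ℂ) * u‖ = |s| := by
  rw [norm_mul, Complex.norm_real, hu, mul_one, Real.norm_eq_abs]

/-- The exterior chart at the boundary: `Φ* (β* t) = ι(∂D(t))`. [folklore] -/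
theorem Ce_apply_β (t : ℝ) : T.Ce.Φ (T.Ce.β t) = invMap T.z₀ (D.boundary t) := T.Ce.apply_β t

/-- The exterior branch at `s = 1` is the boundary point too. [folklore] -/
theorem exterior_branch_one (t : ℝ) : invMapInv T.z₀ (T.Ce.Φ (((2 - 1 : ℝ) : ℂ) * T.Ce.β t)) = D.boundary t := by
  rw [show ((2 - 1 : ℝ) : ℂ) = 1 by norm_num, one_mul, Ce_apply_β, invMapInv_invMap]

/-- `tube 1 t = ∂D(t)`. [folklore] -/
@[simp] theorem tube_one (t : ℝ) : T.tube 1 t = D.boundary t := by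
  rw [T.tube_of_le_one le_rfl, Complex.ofReal_one, one_mul, DiscChart.apply_β]

/-- For `0 ≤ s < 1` (indeed `|s| < 1`) the tube point lies in `D`. [folklore] -/
theorem tube_mem_carrier {s : ℝ} (hs : |s| < 1) (t : ℝ) : T.tube s t ∈ D.carrier := by
  rw [T.tube_of_le_one (abs_lt.1 hs).2.le]
  exact T.Ci.apply_mem_carrier (by rw [norm_real_mul_of_norm_eq_one (T.Ci.norm_β t)]; exact hs)

/-- For `|s| ≤ 1` the tube point lies in `closure D`. [folklore] -/
theorem tube_mem_closure {s : ℝ} (hs : |s| ≤ 1) (t : ℝ) : T.tube s t ∈ closure D.carrier := by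
  rw [T.tube_of_le_one (abs_le.1 hs).2]
  exact T.Ci.apply_mem_closure (by rw [norm_real_mul_of_norm_eq_one (T.Ci.norm_β t)]; exact hs)

/-- The exterior chart does not vanish at nonzero points of the closed disc. [folklore] -/
theorem Ce_ne_zero {u : ℂ} (hu : ‖u‖ ≤ 1) (hu0 : u ≠ 0) : T.Ce.Φ u ≠ 0 := fun h =>
  hu0 (T.Ce.eq_zero_of_apply_eq hu (h.trans T.Ce_zero.symm))

/-- For `1 < s < 2` the tube point lies outside `closure D`. [folklore] -/
theorem tube_not_mem_closure {s : ℝ} (hs : 1 < s) (hs2 : s < 2) (t : ℝ) : T.tube s t ∉ closure D.carrier := by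
  rw [T.tube_of_one_lt hs]
  have hn : ‖((2 - s : ℝ) : ℂ) * T.Ce.β t‖ = 2 - s := by
    rw [norm_real_mul_of_norm_eq_one (T.Ce.norm_β t), abs_of_pos (by linarith)]
  refine D.invMapInv_not_mem_closure T.hz₀ (T.Ce.apply_mem_carrier (by rw [hn]; linarith)) ?_
  exact T.Ce_ne_zero (by rw [hn]; linarith) (by rw [← norm_pos_iff, hn]; linarith)

/-- For `1 ≤ s < 2` the point of the exterior chart used by the tube is nonzero. [folklore] -/
theorem Ce_branch_ne_zero {s : ℝ} (hs1 : 1 ≤ s) (hs2 : s < 2) (t : ℝ) :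
    T.Ce.Φ (((2 - s : ℝ) : ℂ) * T.Ce.β t) ≠ 0 := by
  have hn : ‖((2 - s : ℝ) : ℂ) * T.Ce.β t‖ = 2 - s := by
    rw [norm_real_mul_of_norm_eq_one (T.Ce.norm_β t), abs_of_pos (by linarith)]
  exact T.Ce_ne_zero (by rw [hn]; linarith) (by rw [← norm_pos_iff, hn]; linarith)

/-- **Continuity of the tube** on `[-1, 2) × ℝ`. [folklore] -/
theorem continuousOn_tube : ContinuousOn (fun q : ℝ × ℝ => T.tube q.1 q.2) {q | -1 ≤ q.1 ∧ q.1 < 2} := by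
  have hβi : Continuous fun q : ℝ × ℝ => ((q.1 : ℝ) : ℂ) * T.Ci.β q.2 :=
    (Complex.continuous_ofReal.comp continuous_fst).mul (T.Ci.continuous_β.comp continuous_snd)
  have hβe : Continuous fun q : ℝ × ℝ => (((2 - q.1 : ℝ)) : ℂ) * T.Ce.β q.2 :=
    (Complex.continuous_ofReal.comp (continuous_const.sub continuous_fst)).mul (T.Ce.continuous_β.comp continuous_snd)
  -- interior branch on `|s| ≤ 1`
  have hf : ContinuousOn (fun q : ℝ × ℝ => T.Ci.Φ (((q.1 : ℝ) : ℂ) * T.Ci.β q.2)) {q | -1 ≤ q.1 ∧ q.1 ≤ 1} := by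
    refine T.Ci.continuousOn.comp hβi.continuousOn fun q hq => ?_
    rw [mem_closedBall_zero_iff, norm_real_mul_of_norm_eq_one (T.Ci.norm_β _)]
    exact abs_le.2 ⟨hq.1, hq.2⟩
  -- exterior branch on `1 ≤ s < 2`
  have hg : ContinuousOn (fun q : ℝ × ℝ => invMapInv T.z₀ (T.Ce.Φ ((((2 - q.1 : ℝ)) : ℂ) * T.Ce.β q.2)))
      {q | 1 ≤ q.1 ∧ q.1 < 2} := by
    have h1 : ContinuousOn (fun q : ℝ × ℝ => T.Ce.Φ ((((2 - q.1 : ℝ)) : ℂ) * T.Ce.β q.2)) {q | 1 ≤ q.1 ∧ q.1 < 2} := by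
      refine T.Ce.continuousOn.comp hβe.continuousOn fun q hq => ?_
      rw [mem_closedBall_zero_iff, norm_real_mul_of_norm_eq_one (T.Ce.norm_β _)]
      exact abs_le.2 ⟨by linarith [hq.2], by linarith [hq.1]⟩
    exact (continuousOn_invMapInv T.z₀).comp h1 fun q hq => T.Ce_branch_ne_zero hq.1 hq.2 q.2
  refine ContinuousOn.if ?_ ?_ ?_
  · rintro q ⟨hq, hqf⟩
    have h1 : q.1 = 1 := frontier_le_subset_eq continuous_fst continuous_const hqf
    simp only [h1, Complex.ofReal_one, one_mul, DiscChart.apply_β, exterior_branch_one]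
  · refine hf.mono ?_
    rintro q ⟨hq, hqc⟩
    exact ⟨hq.1, (closure_le_eq continuous_fst continuous_const).subset hqc⟩
  · refine hg.mono ?_
    rintro q ⟨hq, hqc⟩
    have hsub : {a : ℝ × ℝ | ¬a.1 ≤ 1} ⊆ {a | (1 : ℝ) < a.1} := fun a ha => not_le.1 ha
    have : q ∈ {q : ℝ × ℝ | 1 ≤ q.1} := closure_lt_subset_le continuous_const continuous_fst (closure_mono hsub hqc)
    exact ⟨this, hq.2⟩

/-- Continuity of a tube curve `t ↦ tube (p t) t` along a continuous profile `p` with values in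
`[-1, 2)`. [folklore] -/
theorem continuous_tube_comp {p : ℝ → ℝ} (hp : Continuous p) (hp1 : ∀ t, -1 ≤ p t) (hp2 : ∀ t, p t < 2) :
    Continuous fun t => T.tube (p t) t :=
  T.continuousOn_tube.comp_continuous (hp.prodMk continuous_id) fun t => ⟨hp1 t, hp2 t⟩

/-- Continuity of a tube ray `s ↦ tube s t` on `[-1, 2)`. [folklore] -/
theorem continuousOn_tube_left (t : ℝ) : ContinuousOn (fun s => T.tube s t) (Ico (-1) 2) :=
  T.continuousOn_tube.comp (continuous_id.prodMk continuous_const).continuousOn fun _ hs => ⟨hs.1, hs.2⟩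

/-- **Injectivity of the tube** on `(0, 2) × [0, 1)`. [folklore] -/
theorem injOn_tube : InjOn (fun q : ℝ × ℝ => T.tube q.1 q.2) {q | 0 < q.1 ∧ q.1 < 2 ∧ q.2 ∈ Ico (0 : ℝ) 1} := by
  rintro ⟨s, t⟩ ⟨hs0, hs2, ht⟩ ⟨s', t'⟩ ⟨hs0', hs2', ht'⟩ h
  simp only at h hs0 hs2 ht hs0' hs2' ht'
  -- interior points are in `closure D`, exterior points are not
  have key : ∀ {a a' : ℝ} {b b' : ℝ}, 0 < a → a ≤ 1 → 1 < a' → a' < 2 → T.tube a b ≠ T.tube a' b' := by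
    intro a a' b b' ha0 ha1 ha1' ha2' he
    exact T.tube_not_mem_closure ha1' ha2' b' (he ▸ T.tube_mem_closure (abs_le.2 ⟨by linarith, ha1⟩) b)
  rcases le_or_gt s 1 with hs1 | hs1 <;> rcases le_or_gt s' 1 with hs1' | hs1'
  · rw [T.tube_of_le_one hs1, T.tube_of_le_one hs1'] at h
    have h1 := T.Ci.injOn (mem_closedBall_zero_iff.2 (by rw [norm_real_mul_of_norm_eq_one (T.Ci.norm_β _)]; exact abs_le.2 ⟨by linarith, hs1⟩))
      (mem_closedBall_zero_iff.2 (by rw [norm_real_mul_of_norm_eq_one (T.Ci.norm_β _)]; exact abs_le.2 ⟨by linarith, hs1'⟩)) h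
    have hn := congrArg (fun z : ℂ => ‖z‖) h1
    simp only [norm_real_mul_of_norm_eq_one (T.Ci.norm_β _), abs_of_pos hs0, abs_of_pos hs0'] at hn
    subst hn
    have hb : T.Ci.β t = T.Ci.β t' := mul_left_cancel₀ (Complex.ofReal_ne_zero.2 hs0.ne') h1
    exact Prod.ext rfl (T.Ci.injOn_β ht ht' hb)
  · exact absurd h (key hs0 hs1 hs1' hs2')
  · exact absurd h.symm (key hs0' hs1' hs1 hs2)
  · rw [T.tube_of_one_lt hs1, T.tube_of_one_lt hs1'] at h
    have h0 := congrArg (invMap T.z₀) h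
    rw [invMap_invMapInv, invMap_invMapInv] at h0
    have h1 := T.Ce.injOn (mem_closedBall_zero_iff.2 (by rw [norm_real_mul_of_norm_eq_one (T.Ce.norm_β _)]; exact abs_le.2 ⟨by linarith, by linarith⟩))
      (mem_closedBall_zero_iff.2 (by rw [norm_real_mul_of_norm_eq_one (T.Ce.norm_β _)]; exact abs_le.2 ⟨by linarith, by linarith⟩)) h0
    have hn := congrArg (fun z : ℂ => ‖z‖) h1
    simp only [norm_real_mul_of_norm_eq_one (T.Ce.norm_β _), abs_of_pos (show 0 < 2 - s by linarith),
      abs_of_pos (show 0 < 2 - s' by linarith)] at hn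
    have hss : s = s' := by linarith
    subst hss
    have hb : T.Ce.β t = T.Ce.β t' := mul_left_cancel₀ (Complex.ofReal_ne_zero.2 (show (2 - s : ℝ) ≠ 0 by linarith)) h1
    exact Prod.ext rfl (T.Ce.injOn_β ht ht' hb)

/-- **Tube points converge to the boundary uniformly**: for `ε > 0` there is `h ∈ (0, 1/2]` with
`dist (tube s t) (∂D(t)) < ε` whenever `|s - 1| ≤ h`. [folklore] -/
theorem exists_dist_tube_lt {ε : ℝ} (hε : 0 < ε) :
    ∃ h > 0, h ≤ 1 / 2 ∧ ∀ s t, 1 - h ≤ s → s ≤ 1 + h → dist (T.tube s t) (D.boundary t) < ε := by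
  -- interior: uniform continuity of `Φ` on the closed disc
  obtain ⟨η₁, hη₁, h₁⟩ := Metric.uniformContinuousOn_iff.1
    ((isCompact_closedBall (0 : ℂ) 1).uniformContinuousOn_of_continuous T.Ci.continuousOn) ε hε
  -- exterior: uniform continuity of `κ ∘ Φ*` on the annulus `1/2 ≤ ‖u‖ ≤ 1`
  set A : Set ℂ := {u | 1 / 2 ≤ ‖u‖ ∧ ‖u‖ ≤ 1} with hA
  have hAc : IsCompact A := by
    refine (isCompact_closedBall (0 : ℂ) 1).of_isClosed_subset ?_ fun u hu => mem_closedBall_zero_iff.2 hu.2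
    exact (isClosed_le continuous_const continuous_norm).inter (isClosed_le continuous_norm continuous_const)
  have hG : ContinuousOn (fun u => invMapInv T.z₀ (T.Ce.Φ u)) A := by
    refine (continuousOn_invMapInv T.z₀).comp (T.Ce.continuousOn.mono fun u hu => mem_closedBall_zero_iff.2 hu.2) ?_
    intro u hu
    exact T.Ce_ne_zero hu.2 (by rw [← norm_pos_iff]; linarith [hu.1])
  obtain ⟨η₂, hη₂, h₂⟩ := Metric.uniformContinuousOn_iff.1 (hAc.uniformContinuousOn_of_continuous hG) ε hε
  refine ⟨min (1 / 2) (min (η₁ / 2) (η₂ / 2)), by positivity, min_le_left _ _, fun s t hs hs' => ?_⟩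
  have hh1 : min (1 / 2) (min (η₁ / 2) (η₂ / 2)) ≤ η₁ / 2 := (min_le_right _ _).trans (min_le_left _ _)
  have hh2 : min (1 / 2) (min (η₁ / 2) (η₂ / 2)) ≤ η₂ / 2 := (min_le_right _ _).trans (min_le_right _ _)
  have hh0 : min (1 / 2) (min (η₁ / 2) (η₂ / 2)) ≤ 1 / 2 := min_le_left _ _
  rcases le_or_gt s 1 with hs1 | hs1
  · rw [T.tube_of_le_one hs1, ← T.Ci.apply_β t]
    refine h₁ _ (mem_closedBall_zero_iff.2 ?_) _ (mem_closedBall_zero_iff.2 (T.Ci.norm_β t).le) ?_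
    · rw [norm_real_mul_of_norm_eq_one (T.Ci.norm_β _)]; exact abs_le.2 ⟨by linarith, hs1⟩
    · rw [dist_eq_norm, show (s : ℂ) * T.Ci.β t - T.Ci.β t = ((s - 1 : ℝ) : ℂ) * T.Ci.β t by push_cast; ring,
        norm_real_mul_of_norm_eq_one (T.Ci.norm_β _), abs_sub_comm, abs_of_nonneg (by linarith)]
      linarith
  · rw [T.tube_of_one_lt hs1, ← invMapInv_invMap T.z₀ (D.boundary t), ← T.Ce_apply_β t]
    have hn : ‖((2 - s : ℝ) : ℂ) * T.Ce.β t‖ = 2 - s := by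
      rw [norm_real_mul_of_norm_eq_one (T.Ce.norm_β t), abs_of_pos (by linarith)]
    refine h₂ _ ⟨by rw [hn]; linarith, by rw [hn]; linarith⟩ _ ⟨by rw [T.Ce.norm_β]; norm_num, (T.Ce.norm_β t).le⟩ ?_
    rw [dist_eq_norm, show ((2 - s : ℝ) : ℂ) * T.Ce.β t - T.Ce.β t = ((1 - s : ℝ) : ℂ) * T.Ce.β t by push_cast; ring,
      norm_real_mul_of_norm_eq_one (T.Ce.norm_β _), abs_of_nonpos (by linarith)]
    linarith

/-- **Inner levels keep off the boundary**: for `0 < h < 1` there is `m > 0` with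
`infDist (tube s t) ∂D ≥ m` for all `|s| ≤ 1 - h`. [folklore] -/
theorem exists_le_infDist_tube_inner {h : ℝ} (hh : 0 < h) (hh1 : h < 1) :
    ∃ m > 0, ∀ s t, |s| ≤ 1 - h → m ≤ infDist (T.tube s t) (frontier D.carrier) := by
  set K := T.Ci.Φ '' closedBall (0 : ℂ) (1 - h) with hK
  have hKc : IsCompact K := (isCompact_closedBall _ _).image_of_continuousOn
    (T.Ci.continuousOn.mono (closedBall_subset_closedBall (by linarith)))
  have hKD : K ⊆ D.carrier := by
    rintro _ ⟨u, hu, rfl⟩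
    exact T.Ci.apply_mem_carrier ((mem_closedBall_zero_iff.1 hu).trans_lt (by linarith))
  have hKne : K.Nonempty := ⟨_, 0, mem_closedBall_self (by linarith), rfl⟩
  obtain ⟨z, hzK, hzmin⟩ := hKc.exists_isMinOn hKne (continuous_infDist_pt (frontier D.carrier)).continuousOn
  refine ⟨infDist z (frontier D.carrier), D.infDist_frontier_pos (hKD hzK), fun s t hs => hzmin ?_⟩
  rw [T.tube_of_le_one ((le_abs_self s).trans (hs.trans (by linarith)))]
  exact ⟨_, mem_closedBall_zero_iff.2 (by rw [norm_real_mul_of_norm_eq_one (T.Ci.norm_β _)]; exact hs), rfl⟩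

/-- **Outer levels keep off the closure**: for `0 < h ≤ 1/2` there is `m > 0` with
`infDist (tube s t) (closure D) ≥ m` for all `1 + h ≤ s ≤ 3/2`. [folklore] -/
theorem exists_le_infDist_tube_outer {h : ℝ} (hh : 0 < h) (hh1 : h ≤ 1 / 2) :
    ∃ m > 0, ∀ s t, 1 + h ≤ s → s ≤ 3 / 2 → m ≤ infDist (T.tube s t) (closure D.carrier) := by
  set A : Set ℂ := {u | 1 / 2 ≤ ‖u‖ ∧ ‖u‖ ≤ 1 - h} with hA
  have hAc : IsCompact A := by
    refine (isCompact_closedBall (0 : ℂ) 1).of_isClosed_subset ?_ fun u hu => mem_closedBall_zero_iff.2 (hu.2.trans (by linarith))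
    exact (isClosed_le continuous_const continuous_norm).inter (isClosed_le continuous_norm continuous_const)
  have hG : ContinuousOn (fun u => invMapInv T.z₀ (T.Ce.Φ u)) A := by
    refine (continuousOn_invMapInv T.z₀).comp (T.Ce.continuousOn.mono fun u hu => mem_closedBall_zero_iff.2 (hu.2.trans (by linarith))) ?_
    intro u hu
    exact T.Ce_ne_zero (hu.2.trans (by linarith)) (by rw [← norm_pos_iff]; linarith [hu.1])
  set K := (fun u => invMapInv T.z₀ (T.Ce.Φ u)) '' A with hK
  have hKc : IsCompact K := hAc.image_of_continuousOn hG
  have hKE : ∀ z ∈ K, z ∉ closure D.carrier := by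
    rintro _ ⟨u, hu, rfl⟩
    refine D.invMapInv_not_mem_closure T.hz₀ (T.Ce.apply_mem_carrier (hu.2.trans_lt (by linarith))) ?_
    exact T.Ce_ne_zero (hu.2.trans (by linarith)) (by rw [← norm_pos_iff]; linarith [hu.1])
  have hβA : ∀ s t, 1 + h ≤ s → s ≤ 3 / 2 → ((2 - s : ℝ) : ℂ) * T.Ce.β t ∈ A := by
    intro s t hs hs'
    have hn : ‖((2 - s : ℝ) : ℂ) * T.Ce.β t‖ = 2 - s := by
      rw [norm_real_mul_of_norm_eq_one (T.Ce.norm_β t), abs_of_pos (by linarith)]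
    exact ⟨by rw [hn]; linarith, by rw [hn]; linarith⟩
  have hKne : K.Nonempty := ⟨_, _, hβA (3 / 2) 0 (by linarith) le_rfl, rfl⟩
  obtain ⟨z, hzK, hzmin⟩ := hKc.exists_isMinOn hKne (continuous_infDist_pt (closure D.carrier)).continuousOn
  have hpos : 0 < infDist z (closure D.carrier) :=
    (isClosed_closure.notMem_iff_infDist_pos (D.nonempty.mono subset_closure)).1 (hKE z hzK)
  refine ⟨_, hpos, fun s t hs hs' => hzmin ?_⟩
  rw [T.tube_of_one_lt (by linarith)]
  exact ⟨_, hβA s t hs hs', rfl⟩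

/-- **Inner escape**: for `0 ≤ s₀ < 1` the inner ray `{tube s t : 0 ≤ s ≤ s₀}` is a connected subset
of `D` containing the centre `z₀` and `tube s₀ t`. [folklore] -/
theorem exists_inner_escape {s₀ : ℝ} (hs0 : 0 ≤ s₀) (hs1 : s₀ < 1) (t : ℝ) :
    ∃ S : Set ℂ, IsConnected S ∧ S ⊆ D.carrier ∧ T.z₀ ∈ S ∧ T.tube s₀ t ∈ S ∧
      ∀ z ∈ S, ∃ s, 0 ≤ s ∧ s ≤ s₀ ∧ z = T.tube s t := by
  refine ⟨(fun s => T.tube s t) '' Icc 0 s₀, ?_, ?_, ?_, ⟨s₀, right_mem_Icc.2 hs0, rfl⟩, ?_⟩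
  · exact (isConnected_Icc hs0).image _ ((T.continuousOn_tube_left t).mono fun s hs => ⟨by linarith [hs.1], by linarith [hs.2]⟩)
  · rintro _ ⟨s, hs, rfl⟩
    exact T.tube_mem_carrier (abs_lt.2 ⟨by linarith [hs.1], hs.2.trans_lt hs1⟩) t
  · refine ⟨0, left_mem_Icc.2 hs0, ?_⟩
    show T.tube 0 t = T.z₀
    rw [T.tube_of_le_one zero_le_one, Complex.ofReal_zero, zero_mul, T.Ci_zero]
  · rintro _ ⟨s, hs, rfl⟩
    exact ⟨s, hs.1, hs.2, rfl⟩

/-- **Outer escape**: for `1 < s₀ < 2` the outer ray `{tube s t : s₀ ≤ s < 2}` is a connected,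
unbounded set containing `tube s₀ t`. [folklore] -/
theorem exists_outer_escape {s₀ : ℝ} (hs1 : 1 < s₀) (hs2 : s₀ < 2) (t : ℝ) :
    ∃ S : Set ℂ, IsConnected S ∧ ¬ IsBounded S ∧ T.tube s₀ t ∈ S ∧
      ∀ z ∈ S, ∃ s, s₀ ≤ s ∧ s < 2 ∧ z = T.tube s t := by
  refine ⟨(fun s => T.tube s t) '' Ico s₀ 2, ?_, ?_, ⟨s₀, left_mem_Ico.2 hs2, rfl⟩, ?_⟩
  · exact (isConnected_Ico hs2).image _ ((T.continuousOn_tube_left t).mono fun s hs => ⟨by linarith [hs.1], hs.2⟩)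
  · -- as `s → 2`, `Φ*((2 - s) β*) → Φ*(0) = 0`, so `κ` of it is unbounded
    intro hb
    obtain ⟨M, hM⟩ := hb.subset_closedBall 0
    have hM0 : 0 ≤ M := by
      have := hM ⟨s₀, left_mem_Ico.2 hs2, rfl⟩
      exact le_trans (norm_nonneg _) (mem_closedBall_zero_iff.1 this)
    -- continuity of `Φ*` at `0` within the closed disc
    have hc : ContinuousWithinAt T.Ce.Φ (closedBall 0 1) 0 := T.Ce.continuousOn 0 (mem_closedBall_self zero_le_one)
    have hε : (0 : ℝ) < (M + ‖T.z₀‖ + 1)⁻¹ := by positivity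
    obtain ⟨η, hη, hηc⟩ := (Metric.continuousWithinAt_iff.1 hc) _ hε
    -- a radius `λ = 2 - s` below `η` and below `2 - s₀`
    set lam := min (η / 2) ((2 - s₀) / 2) with hlam
    have hlam0 : 0 < lam := lt_min (by linarith) (by linarith)
    have hlamη : lam < η := (min_le_left _ _).trans_lt (by linarith)
    have hlams : lam ≤ (2 - s₀) / 2 := min_le_right _ _
    set u : ℂ := ((lam : ℝ) : ℂ) * T.Ce.β t with hu
    have hun : ‖u‖ = lam := by rw [hu, norm_real_mul_of_norm_eq_one (T.Ce.norm_β t), abs_of_pos hlam0]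
    have hu1 : u ∈ closedBall (0 : ℂ) 1 := mem_closedBall_zero_iff.2 (by rw [hun]; linarith)
    have hsmall : ‖T.Ce.Φ u‖ < (M + ‖T.z₀‖ + 1)⁻¹ := by
      have := hηc hu1 (by rw [dist_zero_right, hun]; exact hlamη)
      rwa [T.Ce_zero, dist_zero_right] at this
    have hne : T.Ce.Φ u ≠ 0 := T.Ce_ne_zero (by rw [hun]; linarith) (by rw [← norm_pos_iff, hun]; exact hlam0)
    -- the tube point at `s = 2 - lam` is far
    have hmem : T.tube (2 - lam) t ∈ (fun s => T.tube s t) '' Ico s₀ 2 := ⟨2 - lam, ⟨by linarith, by linarith⟩, rfl⟩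
    have hfar := mem_closedBall_zero_iff.1 (hM hmem)
    rw [T.tube_of_one_lt (by linarith), show (2 - (2 - lam) : ℝ) = lam by ring] at hfar
    change ‖invMapInv T.z₀ (T.Ce.Φ u)‖ ≤ M at hfar
    have h1 : ‖(T.Ce.Φ u)⁻¹‖ ≤ ‖invMapInv T.z₀ (T.Ce.Φ u)‖ + ‖T.z₀‖ := by
      rw [invMapInv]
      calc ‖(T.Ce.Φ u)⁻¹‖ = ‖T.z₀ + (T.Ce.Φ u)⁻¹ - T.z₀‖ := by rw [add_sub_cancel_left]
        _ ≤ ‖T.z₀ + (T.Ce.Φ u)⁻¹‖ + ‖T.z₀‖ := norm_sub_le _ _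
    have h2 : (M + ‖T.z₀‖ + 1) < ‖(T.Ce.Φ u)⁻¹‖ := by
      rw [norm_inv]
      rwa [lt_inv_comm₀ (by positivity) (norm_pos_iff.2 hne)]
    linarith
  · rintro _ ⟨s, hs, rfl⟩
    exact ⟨s, hs.1, hs.2, rfl⟩

end TubeData

end JordanDomain

end Literature.Probability.RandomPlanarGeometry
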